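import Summits.NavierStokesRegularity.TurbBounds.ShearForm
import Summits.NavierStokesRegularity.TurbBounds.LayerDensity
import HarnessLib

/-!
# Density step for the shear certificates: positivity of the relaxed form on admissible POLYNOMIAL pairs implies positivity on the
# whole admissible `C²` class (`W(±1) = 0`, `W′(−1) = 0`)
(cell `pub-turb` / `turb-bounds`, shear lane; v2 staging. Written by pub-turb-shear gen 7, 2026-08-22. Pattern: the tree's one-sided
`LayerDensity` (cert lane) plus a far-wall correction by the fixed quadratic `(x+1)²/4`, as in cert's staged two-sided `RBDensity`.)

HONEST FRAMING: rigorous bounds for the stated PDE and boundary conditions; no claim about physical turbulence beyond the bound.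
`shearForm_nonneg_of_poly`: for constants `A, C, D`, a continuous profile derivative `φ′` and the relaxed form `shearForm A C D φ′` of
`ShearForm` (rbsdp SPEC 2.2), if the form is `≥ 0` on all pairs of real POLYNOMIALS `(U, V)` with `U(±1) = V(±1) = 0`, `U′(−1) = V′(−1) = 0`
(the class on which the certificates' quadratic forms live: Legendre coefficients, SPEC 2.3–2.8), then it is `≥ 0` on the whole class
`ShearAdmissible` (`C²` pairs, same wall conditions). Proof: Weierstrass-approximate `U″` uniformly on `[−1, 1]`, integrate twice from the
bottom wall (`LegendreCoeffs.primFrom`) — this keeps `U(−1) = U′(−1) = 0` exactly and approximates `U, U′, U″` uniformly — then subtract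
`U_p(1)·(x+1)²/4` to restore `U(1) = 0` (the subtracted term is uniformly small with its two derivatives since `U_p(1) → U(1) = 0`); the
integrand is a polynomial in the six values `U, U′, U″, V, V′, V″` with continuous coefficients, so the forms converge. Elementary
inequalities are REUSED from `LayerDensity` (`sq_sub_sq_le`, `mul_sub_mul_le`, `abs_integral_le`), not restated.
-/

set_option linter.style.longLine false

noncomputable section

namespace Summit.NavierStokesRegularity.TurbBounds.ShearDensity

open Polynomial intervalIntegral MeasureTheory Set
open Summit.NavierStokesRegularity.TurbBounds.ShearForm
open Summit.NavierStokesRegularity.TurbBounds.LegendreCoeffs (primFrom derivative_primFrom eval_primFrom_neg_one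
  eval_primFrom_eq_integral)
open Summit.NavierStokesRegularity.TurbBounds.LayerDensity (sq_sub_sq_le mul_sub_mul_le abs_integral_le)

/-! ## 1. The far-wall correction `c·(x+1)²/4` -/

/-- The fixed correction polynomial `c·(X+1)²/4` (value `c` at `x = 1`, value and derivative `0` at `x = −1`). -/
def corr (c : ℝ) : ℝ[X] := C (c / 4) * (X + C 1) ^ 2

/-- `corr c (x) = (c/4)(x+1)²`. -/
theorem eval_corr (c x : ℝ) : (corr c).eval x = c / 4 * (x + 1) ^ 2 := by
  simp [corr]

/-- `(corr c)′(x) = (c/2)(x+1)`. -/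
theorem eval_derivative_corr (c x : ℝ) : (derivative (corr c)).eval x = c / 2 * (x + 1) := by
  simp [corr, derivative_mul, derivative_pow]
  ring

/-- `(corr c)″(x) = c/2`. -/
theorem eval_derivative_derivative_corr (c x : ℝ) : (derivative (derivative (corr c))).eval x = c / 2 := by
  simp [corr, derivative_mul, derivative_pow]
  ring

/-- On `[−1, 1]`: `|(c/4)(x+1)²| ≤ |c|`. -/
theorem abs_eval_corr_le {c x : ℝ} (hx : x ∈ Icc (-1 : ℝ) 1) : |(corr c).eval x| ≤ |c| := by
  rw [eval_corr, abs_mul, abs_div, abs_of_pos (by norm_num : (0 : ℝ) < 4)]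
  have h1 : |(x + 1) ^ 2| ≤ 4 := by
    rw [abs_of_nonneg (sq_nonneg _)]; nlinarith [hx.1, hx.2]
  calc |c| / 4 * |(x + 1) ^ 2| ≤ |c| / 4 * 4 := by gcongr
    _ = |c| := by ring

/-- On `[−1, 1]`: `|(c/2)(x+1)| ≤ |c|`. -/
theorem abs_eval_derivative_corr_le {c x : ℝ} (hx : x ∈ Icc (-1 : ℝ) 1) : |(derivative (corr c)).eval x| ≤ |c| := by
  rw [eval_derivative_corr, abs_mul, abs_div, abs_of_pos (by norm_num : (0 : ℝ) < 2)]
  have h1 : |x + 1| ≤ 2 := by rw [abs_le]; constructor <;> linarith [hx.1, hx.2]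
  calc |c| / 2 * |x + 1| ≤ |c| / 2 * 2 := by gcongr
    _ = |c| := by ring

/-- `|c/2| ≤ |c|`. -/
theorem abs_eval_derivative_derivative_corr_le (c x : ℝ) : |(derivative (derivative (corr c))).eval x| ≤ |c| := by
  rw [eval_derivative_derivative_corr, abs_div, abs_of_pos (by norm_num : (0 : ℝ) < 2)]
  have := abs_nonneg c
  linarith

/-! ## 2. Polynomial approximation of one admissible component -/

/-- **Uniform `C²` approximation keeping the three wall conditions.** For `U ∈ C²(ℝ)` with `U(−1) = U′(−1) = 0 = U(1)` and `δ > 0` there is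
a real polynomial `U_p` with `U_p(−1) = U_p′(−1) = U_p(1) = 0` and `|U_p″ − U″|, |U_p′ − U′|, |U_p − U| ≤ 8δ` on `[−1, 1]`. -/
theorem exists_poly_approx_wall {U : ℝ → ℝ} (hU : ContDiff ℝ 2 U) (h0 : U (-1) = 0) (h1 : deriv U (-1) = 0) (h2 : U 1 = 0)
    {δ : ℝ} (hδ : 0 < δ) :
    ∃ Up : ℝ[X], Up.eval (-1) = 0 ∧ (derivative Up).eval (-1) = 0 ∧ Up.eval 1 = 0 ∧
      (∀ x ∈ Icc (-1 : ℝ) 1, |(derivative (derivative Up)).eval x - deriv (deriv U) x| ≤ 8 * δ) ∧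
      (∀ x ∈ Icc (-1 : ℝ) 1, |(derivative Up).eval x - deriv U x| ≤ 8 * δ) ∧
      (∀ x ∈ Icc (-1 : ℝ) 1, |Up.eval x - U x| ≤ 8 * δ) := by
  obtain ⟨_, hU1c, hU2c⟩ := contDiff_two_continuous hU
  have hU0d : Differentiable ℝ U := hU.differentiable (by norm_num)
  have hU1d : Differentiable ℝ (deriv U) := by
    have h := hU.differentiable_iteratedDeriv 1 (by norm_num)
    rwa [iteratedDeriv_one] at h
  -- Weierstrass on U'' and two integrations from the wall
  obtain ⟨p, hp⟩ := exists_polynomial_near_of_continuousOn (-1 : ℝ) 1 (deriv (deriv U)) hU2c.continuousOn δ hδ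
  set P1 := primFrom p with hP1
  set P0 := primFrom P1 with hP0
  have hP0' : derivative P0 = P1 := by rw [hP0, derivative_primFrom]
  have hP0'' : derivative (derivative P0) = p := by rw [hP0', hP1, derivative_primFrom]
  have ftc1 : ∀ x, deriv U x = ∫ t in (-1 : ℝ)..x, deriv (deriv U) t := by
    intro x
    rw [integral_eq_sub_of_hasDerivAt (fun t _ => (hU1d t).hasDerivAt) (hU2c.intervalIntegrable _ _), h1, sub_zero]
  have ftc0 : ∀ x, U x = ∫ t in (-1 : ℝ)..x, deriv U t := by
    intro x
    rw [integral_eq_sub_of_hasDerivAt (fun t _ => (hU0d t).hasDerivAt) (hU1c.intervalIntegrable _ _), h0, sub_zero]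
  have e2 : ∀ x ∈ Icc (-1 : ℝ) 1, |(derivative (derivative P0)).eval x - deriv (deriv U) x| ≤ δ := by
    intro x hx; rw [hP0'']; exact (hp x hx).le
  have e1 : ∀ x ∈ Icc (-1 : ℝ) 1, |(derivative P0).eval x - deriv U x| ≤ 2 * δ := by
    intro x hx
    rw [hP0', hP1, eval_primFrom_eq_integral, ftc1 x,
      ← intervalIntegral.integral_sub (p.continuous.intervalIntegrable _ _) (hU2c.intervalIntegrable _ _)]
    exact abs_integral_le (fun t ht => by have h := e2 t ht; rwa [hP0''] at h) hx
  have e0 : ∀ x ∈ Icc (-1 : ℝ) 1, |P0.eval x - U x| ≤ 4 * δ := by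
    intro x hx
    rw [hP0, eval_primFrom_eq_integral, ftc0 x,
      ← intervalIntegral.integral_sub (P1.continuous.intervalIntegrable _ _) (hU1c.intervalIntegrable _ _)]
    have h := abs_integral_le (C := 2 * δ) (fun t ht => by have h := e1 t ht; rwa [hP0'] at h) hx
    linarith
  -- the far-wall defect and its correction
  set c := P0.eval 1 with hc
  have hcδ : |c| ≤ 4 * δ := by
    have h := e0 1 ⟨by norm_num, le_rfl⟩
    rwa [h2, sub_zero] at h
  refine ⟨P0 - corr c, ?_, ?_, ?_, ?_, ?_, ?_⟩
  · rw [eval_sub, eval_corr, hP0, eval_primFrom_neg_one]; norm_num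
  · rw [derivative_sub, eval_sub, eval_derivative_corr, hP0', hP1, eval_primFrom_neg_one]; norm_num
  · rw [eval_sub, eval_corr, ← hc]; ring
  · intro x hx
    rw [derivative_sub, derivative_sub, eval_sub]
    have h := abs_eval_derivative_derivative_corr_le c x
    calc |(derivative (derivative P0)).eval x - (derivative (derivative (corr c))).eval x - deriv (deriv U) x|
        = |((derivative (derivative P0)).eval x - deriv (deriv U) x) - (derivative (derivative (corr c))).eval x| := by ring_nf
      _ ≤ |(derivative (derivative P0)).eval x - deriv (deriv U) x| + |(derivative (derivative (corr c))).eval x| := abs_sub _ _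
      _ ≤ δ + 4 * δ := add_le_add (e2 x hx) (h.trans hcδ)
      _ ≤ 8 * δ := by linarith
  · intro x hx
    rw [derivative_sub, eval_sub]
    have h := abs_eval_derivative_corr_le (c := c) hx
    calc |(derivative P0).eval x - (derivative (corr c)).eval x - deriv U x|
        = |((derivative P0).eval x - deriv U x) - (derivative (corr c)).eval x| := by ring_nf
      _ ≤ |(derivative P0).eval x - deriv U x| + |(derivative (corr c)).eval x| := abs_sub _ _
      _ ≤ 2 * δ + 4 * δ := add_le_add (e1 x hx) (h.trans hcδ)
      _ ≤ 8 * δ := by linarith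
  · intro x hx
    rw [eval_sub]
    have h := abs_eval_corr_le (c := c) hx
    calc |P0.eval x - (corr c).eval x - U x|
        = |(P0.eval x - U x) - (corr c).eval x| := by ring_nf
      _ ≤ |P0.eval x - U x| + |(corr c).eval x| := abs_sub _ _
      _ ≤ 4 * δ + 4 * δ := add_le_add (e0 x hx) (h.trans hcδ)
      _ = 8 * δ := by ring

/-! ## 3. The density theorem -/

/-- Triangle inequality for the shape of the relaxed integrand's difference. -/
theorem abs_shear_comb_le (A C D g d2u d2v d1u d1v d0u d0v pr1 pr2 : ℝ) :
    |A * (d2u + d2v) + 8 * (d1u + d1v) + C * (d0u + d0v) - D * (g * (pr1 - pr2))|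
      ≤ |A| * (|d2u| + |d2v|) + 8 * (|d1u| + |d1v|) + |C| * (|d0u| + |d0v|) + |D| * |g| * (|pr1| + |pr2|) := by
  have h1 : |A * (d2u + d2v)| ≤ |A| * (|d2u| + |d2v|) := by
    rw [abs_mul]; exact mul_le_mul_of_nonneg_left (abs_add_le _ _) (abs_nonneg _)
  have h2 : |8 * (d1u + d1v)| ≤ 8 * (|d1u| + |d1v|) := by
    rw [abs_mul, abs_of_pos (by norm_num : (0 : ℝ) < 8)]
    exact mul_le_mul_of_nonneg_left (abs_add_le _ _) (by norm_num)
  have h3 : |C * (d0u + d0v)| ≤ |C| * (|d0u| + |d0v|) := by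
    rw [abs_mul]; exact mul_le_mul_of_nonneg_left (abs_add_le _ _) (abs_nonneg _)
  have h4 : |D * (g * (pr1 - pr2))| ≤ |D| * |g| * (|pr1| + |pr2|) := by
    rw [abs_mul, abs_mul, mul_assoc]
    exact mul_le_mul_of_nonneg_left (mul_le_mul_of_nonneg_left (abs_sub _ _) (abs_nonneg _)) (abs_nonneg _)
  calc |A * (d2u + d2v) + 8 * (d1u + d1v) + C * (d0u + d0v) - D * (g * (pr1 - pr2))|
      ≤ |A * (d2u + d2v) + 8 * (d1u + d1v) + C * (d0u + d0v)| + |D * (g * (pr1 - pr2))| := abs_sub _ _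
    _ ≤ |A * (d2u + d2v)| + |8 * (d1u + d1v)| + |C * (d0u + d0v)| + |D * (g * (pr1 - pr2))| := by
        linarith [abs_add_three (A * (d2u + d2v)) (8 * (d1u + d1v)) (C * (d0u + d0v))]
    _ ≤ _ := by linarith

/-- **Density.** If the relaxed form (`φ′` continuous) is `≥ 0` on all pairs of polynomial test functions with the wall conditions
`U(±1) = V(±1) = 0`, `U′(−1) = V′(−1) = 0`, it is `≥ 0` on the whole admissible `C²` class. -/
theorem shearForm_nonneg_of_poly {A C D : ℝ} {φp : ℝ → ℝ} (hφ : Continuous φp)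
    (hpoly : ∀ Up Vp : ℝ[X], Up.eval (-1) = 0 → (derivative Up).eval (-1) = 0 → Up.eval 1 = 0 →
      Vp.eval (-1) = 0 → (derivative Vp).eval (-1) = 0 → Vp.eval 1 = 0 →
      0 ≤ shearForm A C D φp (fun x => Up.eval x) (fun x => Vp.eval x))
    {U V : ℝ → ℝ} (hUV : ShearAdmissible U V) : 0 ≤ shearForm A C D φp U V := by
  obtain ⟨hU0c, hU1c, hU2c⟩ := contDiff_two_continuous hUV.hU
  obtain ⟨hV0c, hV1c, hV2c⟩ := contDiff_two_continuous hUV.hV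
  -- bounds on [-1, 1]
  obtain ⟨B2, hB2⟩ := isCompact_Icc.exists_bound_of_continuousOn (hU2c.continuousOn (s := Icc (-1 : ℝ) 1))
  obtain ⟨B1, hB1⟩ := isCompact_Icc.exists_bound_of_continuousOn (hU1c.continuousOn (s := Icc (-1 : ℝ) 1))
  obtain ⟨B0, hB0⟩ := isCompact_Icc.exists_bound_of_continuousOn (hU0c.continuousOn (s := Icc (-1 : ℝ) 1))
  obtain ⟨G2, hG2⟩ := isCompact_Icc.exists_bound_of_continuousOn (hV2c.continuousOn (s := Icc (-1 : ℝ) 1))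
  obtain ⟨G1, hG1⟩ := isCompact_Icc.exists_bound_of_continuousOn (hV1c.continuousOn (s := Icc (-1 : ℝ) 1))
  obtain ⟨G0, hG0⟩ := isCompact_Icc.exists_bound_of_continuousOn (hV0c.continuousOn (s := Icc (-1 : ℝ) 1))
  obtain ⟨Tg, hTg⟩ := isCompact_Icc.exists_bound_of_continuousOn (hφ.continuousOn (s := Icc (-1 : ℝ) 1))
  simp only [Real.norm_eq_abs] at hB2 hB1 hB0 hG2 hG1 hG0 hTg
  have m1 : (-1 : ℝ) ∈ Icc (-1 : ℝ) 1 := ⟨le_rfl, by norm_num⟩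
  have hB2n : 0 ≤ B2 := le_trans (abs_nonneg _) (hB2 _ m1)
  have hB1n : 0 ≤ B1 := le_trans (abs_nonneg _) (hB1 _ m1)
  have hB0n : 0 ≤ B0 := le_trans (abs_nonneg _) (hB0 _ m1)
  have hG2n : 0 ≤ G2 := le_trans (abs_nonneg _) (hG2 _ m1)
  have hG1n : 0 ≤ G1 := le_trans (abs_nonneg _) (hG1 _ m1)
  have hG0n : 0 ≤ G0 := le_trans (abs_nonneg _) (hG0 _ m1)
  have hTgn : 0 ≤ Tg := le_trans (abs_nonneg _) (hTg _ m1)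
  -- the constant
  set Cst : ℝ := |A| * ((2 * B2 + 8) + (2 * G2 + 8)) + 8 * ((2 * B1 + 8) + (2 * G1 + 8)) + |C| * ((2 * B0 + 8) + (2 * G0 + 8))
      + |D| * Tg * ((G1 + B0 + 8) + (B1 + G0 + 8)) with hCst
  have hCst0 : 0 ≤ Cst := by rw [hCst]; positivity
  by_contra hneg
  have hneg : shearForm A C D φp U V < 0 := not_le.mp hneg
  set F := shearForm A C D φp U V with hF
  -- choose δ with 16 δ Cst < -F and δ ≤ 1
  obtain ⟨δ, hδ0, hδ1, hδF⟩ : ∃ δ : ℝ, 0 < δ ∧ δ ≤ 1 ∧ 16 * δ * Cst < -F := by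
    refine ⟨min 1 (-F / (16 * Cst + 16)), ?_, min_le_left _ _, ?_⟩
    · exact lt_min one_pos (div_pos (by linarith) (by positivity))
    · have hle : min 1 (-F / (16 * Cst + 16)) ≤ -F / (16 * Cst + 16) := min_le_right _ _
      have hpos : 0 < 16 * Cst + 16 := by positivity
      calc 16 * min 1 (-F / (16 * Cst + 16)) * Cst ≤ 16 * (-F / (16 * Cst + 16)) * Cst := by gcongr
        _ < -F := by
            rw [div_eq_mul_inv]
            have : 16 * (-F * (16 * Cst + 16)⁻¹) * Cst = -F * (16 * Cst / (16 * Cst + 16)) := by ring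
            rw [this]
            have hlt : 16 * Cst / (16 * Cst + 16) < 1 := by rw [div_lt_one hpos]; linarith
            have hFpos : 0 < -F := by linarith
            nlinarith
  obtain ⟨Up, hU0, hU1, hU2, eU2, eU1, eU0⟩ := exists_poly_approx_wall hUV.hU hUV.U_bot hUV.dU_bot hUV.U_top hδ0
  obtain ⟨Vp, hV0, hV1, hV2, eV2, eV1, eV0⟩ := exists_poly_approx_wall hUV.hV hUV.V_bot hUV.dV_bot hUV.V_top hδ0
  have hpos := hpoly Up Vp hU0 hU1 hU2 hV0 hV1 hV2
  -- pointwise bound on the integrands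
  set η := 8 * δ with hη
  have hη0 : 0 ≤ η := by rw [hη]; linarith
  have hη8 : η ≤ 8 := by rw [hη]; linarith
  have hdU : deriv (fun x => Up.eval x) = fun x => (derivative Up).eval x := by funext x; exact Polynomial.deriv Up
  have hdU1 : deriv (fun x => (derivative Up).eval x) = fun x => (derivative (derivative Up)).eval x := by
    funext x; exact Polynomial.deriv (derivative Up)
  have hdV : deriv (fun x => Vp.eval x) = fun x => (derivative Vp).eval x := by funext x; exact Polynomial.deriv Vp
  have hdV1 : deriv (fun x => (derivative Vp).eval x) = fun x => (derivative (derivative Vp)).eval x := by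
    funext x; exact Polynomial.deriv (derivative Vp)
  have hpt : ∀ x ∈ Icc (-1 : ℝ) 1,
      |shearIntegrand A C D φp (fun x => Up.eval x) (fun x => Vp.eval x) x - shearIntegrand A C D φp U V x| ≤ η * Cst := by
    intro x hx
    have d2u := sq_sub_sq_le (hB2 x hx) (eU2 x hx) hη0
    have d1u := sq_sub_sq_le (hB1 x hx) (eU1 x hx) hη0
    have d0u := sq_sub_sq_le (hB0 x hx) (eU0 x hx) hη0
    have d2v := sq_sub_sq_le (hG2 x hx) (eV2 x hx) hη0
    have d1v := sq_sub_sq_le (hG1 x hx) (eV1 x hx) hη0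
    have d0v := sq_sub_sq_le (hG0 x hx) (eV0 x hx) hη0
    have pr1 := mul_sub_mul_le (hG1 x hx) (hB0 x hx) (eV1 x hx) (eU0 x hx) hη0
    have pr2 := mul_sub_mul_le (hB1 x hx) (hG0 x hx) (eU1 x hx) (eV0 x hx) hη0
    have hg := hTg x hx
    have hdiff : shearIntegrand A C D φp (fun x => Up.eval x) (fun x => Vp.eval x) x - shearIntegrand A C D φp U V x
        = A * (((derivative (derivative Up)).eval x ^ 2 - deriv (deriv U) x ^ 2)
              + ((derivative (derivative Vp)).eval x ^ 2 - deriv (deriv V) x ^ 2))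
          + 8 * (((derivative Up).eval x ^ 2 - deriv U x ^ 2) + ((derivative Vp).eval x ^ 2 - deriv V x ^ 2))
          + C * ((Up.eval x ^ 2 - U x ^ 2) + (Vp.eval x ^ 2 - V x ^ 2))
          - D * (φp x * (((derivative Vp).eval x * Up.eval x - deriv V x * U x)
              - ((derivative Up).eval x * Vp.eval x - deriv U x * V x))) := by
      simp only [shearIntegrand, hdU, hdU1, hdV, hdV1]
      ring
    rw [hdiff]
    refine (abs_shear_comb_le _ _ _ _ _ _ _ _ _ _ _ _).trans ?_
    have hA0 := abs_nonneg A
    have hC0 := abs_nonneg C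
    have hD0 := abs_nonneg D
    calc |A| * (|(derivative (derivative Up)).eval x ^ 2 - deriv (deriv U) x ^ 2| + |(derivative (derivative Vp)).eval x ^ 2 - deriv (deriv V) x ^ 2|)
          + 8 * (|(derivative Up).eval x ^ 2 - deriv U x ^ 2| + |(derivative Vp).eval x ^ 2 - deriv V x ^ 2|)
          + |C| * (|Up.eval x ^ 2 - U x ^ 2| + |Vp.eval x ^ 2 - V x ^ 2|)
          + |D| * |φp x| * (|(derivative Vp).eval x * Up.eval x - deriv V x * U x| + |(derivative Up).eval x * Vp.eval x - deriv U x * V x|)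
        ≤ |A| * (η * (2 * B2 + η) + η * (2 * G2 + η)) + 8 * (η * (2 * B1 + η) + η * (2 * G1 + η))
          + |C| * (η * (2 * B0 + η) + η * (2 * G0 + η)) + |D| * Tg * (η * (G1 + B0 + η) + η * (B1 + G0 + η)) := by
          gcongr
      _ ≤ |A| * (η * (2 * B2 + 8) + η * (2 * G2 + 8)) + 8 * (η * (2 * B1 + 8) + η * (2 * G1 + 8))
          + |C| * (η * (2 * B0 + 8) + η * (2 * G0 + 8)) + |D| * Tg * (η * (G1 + B0 + 8) + η * (B1 + G0 + 8)) := by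
          gcongr
      _ = η * Cst := by rw [hCst]; ring
  -- continuity of both integrands
  have hIp : Continuous (shearIntegrand A C D φp (fun x => Up.eval x) (fun x => Vp.eval x)) := by
    have : shearIntegrand A C D φp (fun x => Up.eval x) (fun x => Vp.eval x)
        = fun x => A * (((derivative (derivative Up)).eval x) ^ 2 + ((derivative (derivative Vp)).eval x) ^ 2)
            + 8 * (((derivative Up).eval x) ^ 2 + ((derivative Vp).eval x) ^ 2) + C * ((Up.eval x) ^ 2 + (Vp.eval x) ^ 2)
            - D * (φp x * ((derivative Vp).eval x * Up.eval x - (derivative Up).eval x * Vp.eval x)) := by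
      funext x; simp only [shearIntegrand, hdU, hdU1, hdV, hdV1]
    rw [this]; fun_prop
  have hI : Continuous (shearIntegrand A C D φp U V) := by
    have : shearIntegrand A C D φp U V
        = fun x => A * ((deriv (deriv U) x) ^ 2 + (deriv (deriv V) x) ^ 2) + 8 * ((deriv U x) ^ 2 + (deriv V x) ^ 2)
            + C * ((U x) ^ 2 + (V x) ^ 2) - D * (φp x * (deriv V x * U x - deriv U x * V x)) := by
      funext x; simp only [shearIntegrand]
    rw [this]; fun_prop
  have hdiffInt : |shearForm A C D φp (fun x => Up.eval x) (fun x => Vp.eval x) - F| ≤ 2 * (η * Cst) := by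
    rw [hF]
    unfold shearForm
    rw [← intervalIntegral.integral_sub (hIp.intervalIntegrable _ _) (hI.intervalIntegrable _ _)]
    have h1 : ‖∫ x in (-1 : ℝ)..1, (shearIntegrand A C D φp (fun x => Up.eval x) (fun x => Vp.eval x) x
        - shearIntegrand A C D φp U V x)‖ ≤ (η * Cst) * |1 - (-1)| := by
      refine norm_integral_le_of_norm_le_const fun t ht => ?_
      rw [Real.norm_eq_abs]
      rcases Set.mem_uIoc.mp ht with h' | h'
      · exact hpt t ⟨h'.1.le, h'.2⟩
      · exfalso; linarith [h'.1, h'.2]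
    rw [Real.norm_eq_abs] at h1
    have : |(1 : ℝ) - (-1)| = 2 := by norm_num
    rw [this] at h1
    linarith
  have : 2 * (η * Cst) = 16 * δ * Cst := by rw [hη]; ring
  rw [this] at hdiffInt
  have h := abs_le.mp hdiffInt
  linarith [h.1, h.2, hpos, hδF, hneg]

end Summit.NavierStokesRegularity.TurbBounds.ShearDensity

end
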